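import Literature.AlgebraicGeometry.Resolution.InseparableLocalUniformizationHeightInductionTower
import Literature.AlgebraicGeometry.Resolution.InseparableLocalUniformizationStepsThreeFourHolds
import Literature.AlgebraicGeometry.Resolution.DecompletionRoof
import HarnessLib

/-!
# Temkin 2013, §4.2: the discharge `Temkin2013HeightStepOfDescent_holds`

Topic: `Literature/AlgebraicGeometry/Resolution`. M. Temkin, *Inseparable local uniformization*,
J. Algebra 373 (2013) 65–119 = arXiv:0804.1554v3, §4.2 "Induction on height" (pp. 50–51).
The named fact `Temkin2013HeightStepOfDescent` (`InseparableLocalUniformizationDescent.lean`: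
the descent theorem Thm. 4.1.1 in height `≤ 1` and the corrected relative Thm. 1.3.2 in height
`≤ n`, `n ≥ 1`, give it in height `≤ n + 1`) was reduced in
`InseparableLocalUniformizationHeightInductionTower.lean`
(`Temkin2013HeightStepOfDescent.of_lemma332nft_steps34tower`) to the decompletion Lemma 3.3.2
(`Temkin2013_Lemma332_nft`) and Steps 3–4 of the proof of Thm. 4.1.1
(`Temkin2013_Steps34_tower`). Both are now theorems of the tree
(`Temkin2013_Lemma332_nft_holds`, `DecompletionRoof.lean`; `Temkin2013_Steps34_tower_holds`,
`InseparableLocalUniformizationStepsThreeFourHolds.lean`), so the fact is discharged by pure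
composition. No definition, no new statement.

## Sources

* M. Temkin, *Inseparable local uniformization*, J. Algebra 373 (2013) 65–119,
  arXiv:0804.1554v3: §4.2 (pp. 50–51), Lemma 3.3.2 (pp. 45–46), proof of Thm. 4.1.1, Steps 3–4
  (pp. 48–49). [Temkin2013]
-/

namespace Literature.AlgebraicGeometry.Resolution

universe u

/-- **Temkin 2013, §4.2, the induction step on the height with the descent theorem as input
(`Temkin2013HeightStepOfDescent`) — PROVED**: Lemma 3.3.2 and Steps 3–4 of Thm. 4.1.1 are
theorems, and `Temkin2013HeightStepOfDescent.of_lemma332nft_steps34tower` composes them with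
Steps 0–2 of §4.2. [cite: Temkin2013, Section 4.2 (arXiv:0804.1554v3 pp. 50–51)] -/
theorem Temkin2013HeightStepOfDescent_holds : Temkin2013HeightStepOfDescent.{u} :=
  Temkin2013HeightStepOfDescent.of_lemma332nft_steps34tower Temkin2013_Lemma332_nft_holds
    Temkin2013_Steps34_tower_holds

end Literature.AlgebraicGeometry.Resolution
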